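import Summits.ResolutionOfSingularities.ResolutionOfSingularities.Theorems.WeightedInvariantLocalWeightedDropTrackCStep
import Summits.ResolutionOfSingularities.ResolutionOfSingularities.Theorems.WeightedInvariantLocalWeightedDropTrackCNCPayload
import Summits.ResolutionOfSingularities.ResolutionOfSingularities.Theorems.WeightedInvariantLocalWeightedDropTupleDropAssembly
import Summits.ResolutionOfSingularities.ResolutionOfSingularities.Theorems.WeightedInvariantLocalWeightedDropWildTerminalCalculus

/-!
# Track C with the NORMAL-CROSSING payload: the blow-up step (off the centre, and the move of the count on the centre)

[OURS · L1 W4.3 · chain w43, engine crux `LocalWeightedDrop` stmt-ResolutionOfSingularities-8899; res-type-088, piece (A3-β)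
of strategist res-L1-w43-strat-1's line `tame-four-tuple-drop` ((A3) `stub_spaceNonNCCountRad_of_CJS`; cut and hands per
strat-1's RULING 05:42:56Z: (A3-α) game layer res-type-056, (A3-β) transfer res-type-088)] NOT a statement of any manuscript.

PAYLOAD-PARAMETRIC TOWER PREDICATE.  For predicates `W` ("won within the allotted rounds") on germs `k⟦X₀,X₁,X₂⟧` and a germ
`b`, the tower statement at a `Z₀`-scheme `σ : Z ⟶ Z₀ = Spec k⟦x₀,x₁,x₂⟧` is
  «at every framed point `z` and every Cohen frame `F`, every NON-ZERO divisor `g` of the total transform of `b` read in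
   `F` satisfies `W g`»
(written out in full in each statement; no definition is introduced here).  Along a blow-up step `τ : Z'' ⟶ Z'` it is pulled
DOWN from `(W', τ ≫ σ)` to `(W, σ)` provided
* `W' ≤ W` (off the centre: the frame is transported along the local isomorphism — `exists_frame_over_of_not_mem_support`,
  the payload-free content of Track C's `won_of_wonAt_blowup_of_not_mem_support`);
* `W` is closed under THE MOVE OF THE COUNT GAME towards `W'`: for a legal coordinate change `Φ` and weights `w ∈ {0,1}³ ∖ 0`
  such that at every exceptional point `c` (with `c_l = 0` on the weight-`0` slots, `c ≠ 0`) and every factorisation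
  `g∘Φ(chart_{w,c}) = s^A·G`, `s ∤ G`, some live slot `i` has `W' (s · G|_{y_i' = 0})`, conclude `W g`
  (the `move` rule of res-type-056's `WinsIn` / the clause (iii) of the line's count);
* the centre lies over `V(b)` (`V(C) ⊆ σ⁻¹ V(b)`: then the total transform vanishes on the centre, `T_z ∈ C_z`).
On the centre the Prover plays, in the frame `F'` ADAPTED to a regular system of parameters `x` with `C_z = (x_l)_{l<n}`
(Matsumura 14.2), the coordinate change `φ : F → F'` itself and the weights `𝟙_{l<n}` — the blow-up of the centre; at the
Refuter's exceptional point `c` the completed blow-up at the corresponding point `x' ∈ Z''` IS the restricted chart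
substitution (Track C's `exists_frame_square`), so the total transform above reads `slice_i (T_z∘φ∘chart)`, which
`s · slice_i G` divides because `s ∣ T_z∘φ∘chart` (`T_z ∈ C_z`) and `s` is prime.  Everything geometric is Track C's
(res-L1-w43-stub-4, files `…TrackCChartPoint/ChartHom/ChartFrame/Step`); only the payload changed.

* `totalGerm_mem_stalkIdeal_of_support_subset` — `V(C) ⊆ σ⁻¹ V(b)`, `V(C)` regular ⇒ `T_z ∈ C_z`.
* `exists_frame_over_of_not_mem_support` — off the centre, a frame above with the SAME reading of the total transform.
* `ncStep` — the step.
-/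

noncomputable section

open CategoryTheory CategoryTheory.Limits AlgebraicGeometry TopologicalSpace IsLocalRing
open Literature.AlgebraicGeometry.Resolution
open Scheme.IdealSheafData

set_option linter.dupNamespace false -- mandated namespace of this single-conjunct summit

namespace Summit.ResolutionOfSingularities.ResolutionOfSingularities.Theorems.TrackC

variable {k : Type} [Field k]

/-! ## The total transform vanishes on a centre lying over `V(b)` -/

/-- **`T_z ∈ C_z`.** If the (regular) centre `V(C)` lies over `V(b)`, the total transform of `b` at a point `z` of the centre
belongs to the stalk of the centre's ideal: `√(T_z) = I(σ⁻¹V(b))_z ≤ I(V(C))_z = √(C_z) = C_z`, the last because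
`𝒪_{Z',z}/C_z` is a regular local ring, hence a domain. [OURS · folklore] -/
theorem totalGerm_mem_stalkIdeal_of_support_subset (b : MvPowerSeries (Fin 3) k) {Z' : Scheme.{0}} [IsLocallyNoetherian Z']
    (σ : Z' ⟶ Spec (.of (MvPowerSeries (Fin 3) k))) (C : Z'.IdealSheafData) (hreg : Scheme.IsRegular C.subscheme)
    (hsuppV : (C.support : Set Z') ⊆ σ ⁻¹' ((Spec (.of (MvPowerSeries (Fin 3) k))).zeroLocus (U := ⊤)
      {(Scheme.ΓSpecIso (.of (MvPowerSeries (Fin 3) k))).inv.hom b} : Set _))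
    {z : Z'} (hz : z ∈ C.support) : totalGerm σ z b ∈ stalkIdeal C z := by
  have hrad := radical_span_totalGerm σ b z
  have hle : (C.support : Closeds Z') ≤ ⟨σ ⁻¹' _, (isClosed_zeroLocus b).preimage σ.continuous⟩ := hsuppV
  have h1 : totalGerm σ z b ∈ stalkIdeal (vanishingIdeal C.support) z := by
    have hmem : totalGerm σ z b ∈ (Ideal.span {totalGerm σ z b}).radical :=
      Ideal.le_radical (Ideal.mem_span_singleton_self _)
    rw [hrad] at hmem
    exact stalkIdeal_mono (vanishingIdeal_antimono hle) z hmem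
  rw [vanishingIdeal_support, stalkIdeal_radical] at h1
  haveI := isRegularLocalRing_quotient_of_isRegular_subscheme C hreg hz
  haveI : IsDomain ((Z'.presheaf.stalk z) ⧸ stalkIdeal C z) := isDomain_of_isRegularLocalRing _
  have hprime : (stalkIdeal C z).IsPrime := (Ideal.Quotient.isDomain_iff_prime _).mp inferInstance
  rwa [hprime.radical] at h1

/-! ## Off the centre: a frame above with the same reading -/

/-- **Off the centre** a blow-up is a local isomorphism: for `z ∉ V(C)` and a frame `F` at `z` there is a point `x'` over `z`
and a frame at `x'` in which the total transform of `b` reads EXACTLY as in `F` (transport along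
`𝒪_{Z',z} ≅ 𝒪_{Z'',x'}`; the payload-free content of `won_of_wonAt_blowup_of_not_mem_support`). [OURS · folklore] -/
theorem exists_frame_over_of_not_mem_support (b : MvPowerSeries (Fin 3) k)
    {Z' Z'' : Scheme.{0}} (σ : Z' ⟶ Spec (.of (MvPowerSeries (Fin 3) k))) (C : Z'.IdealSheafData)
    (τ : Z'' ⟶ Z') (hτ : IsBlowup τ C) {z : Z'} (hz : z ∉ C.support)
    (hN : IsNoetherianRing (Z'.presheaf.stalk z)) (F : @Frame k _ Z' σ z hN) :
    ∃ (x' : Z'') (hN'' : IsNoetherianRing (Z''.presheaf.stalk x')) (F'' : @Frame k _ Z'' (τ ≫ σ) x' hN''),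
      F''.e (algebraMap _ _ (totalGerm (τ ≫ σ) x' b)) = F.e (algebraMap _ _ (totalGerm σ z b)) := by
  obtain ⟨x', rfl⟩ := exists_preimage_of_not_mem_support hτ hz
  haveI := hτ.isIso_stalkMap_of_not_mem_support (x' := x') hz
  haveI := hN
  let ε : Z'.presheaf.stalk (τ x') ≃+* Z''.presheaf.stalk x' := (asIso (τ.stalkMap x')).commRingCatIsoToRingEquiv
  have hε : ∀ a, ε a = (τ.stalkMap x').hom a := fun a => rfl
  haveI hN'' : IsNoetherianRing (Z''.presheaf.stalk x') := isNoetherianRing_of_ringEquiv _ ε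
  have hmax : (maximalIdeal (Z'.presheaf.stalk (τ x'))).map ε.toRingHom = maximalIdeal (Z''.presheaf.stalk x') :=
    map_ringEquiv_maximalIdeal ε
  let εh := adicCompletionCongr _ _ ε hmax
  have hgerm : ∀ s : Γ(Z', ⊤), (Z''.presheaf.germ ⊤ x' trivial).hom (τ.appTop.hom s) =
      ε ((Z'.presheaf.germ ⊤ (τ x') trivial).hom s) := fun s => by
    rw [hε]
    exact (Scheme.Hom.germ_stalkMap_apply τ ⊤ x' trivial s).symm
  let F'' : @Frame k _ Z'' (τ ≫ σ) x' hN'' :=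
    { e := εh.symm.trans F.e
      map_const := fun a => by
        have h1 : stalkConst (τ ≫ σ) x' a = ε (stalkConst σ (τ x') a) := by
          change (Z''.presheaf.germ ⊤ x' trivial).hom ((τ ≫ σ).appTop.hom _) = _
          rw [Scheme.Hom.comp_appTop, CommRingCat.comp_apply, hgerm]
          rfl
        change F.e (εh.symm (AdicCompletion.of _ _ (stalkConst (τ ≫ σ) x' a))) = _
        rw [h1, ← adicCompletionCongr_of _ _ ε hmax, RingEquiv.symm_apply_apply]
        exact F.map_const a }
  refine ⟨x', hN'', F'', ?_⟩
  have h2 : totalGerm (τ ≫ σ) x' b = ε (totalGerm σ (τ x') b) := by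
    change (Z''.presheaf.germ ⊤ x' trivial).hom ((τ ≫ σ).appTop.hom _) = _
    rw [Scheme.Hom.comp_appTop, CommRingCat.comp_apply, hgerm]
    rfl
  change F.e (εh.symm (AdicCompletion.of _ _ (totalGerm (τ ≫ σ) x' b))) = _
  rw [h2, ← adicCompletionCongr_of _ _ ε hmax, RingEquiv.symm_apply_apply]
  rfl

/-! ## The step -/

/-- **THE BLOW-UP STEP with the normal-crossing payload.** For a blow-up `τ : Z'' ⟶ Z'` of an integral locally Noetherian
`Z'`-scheme over `Z₀ = Spec k⟦x₀,x₁,x₂⟧` along a non-zero centre `C` with `V(C)` regular and `V(C) ⊆ σ⁻¹V(b)`, and predicates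
`W' ≤ W` with `W` closed under the count's move towards `W'` (module docstring): if above, every non-zero divisor of the total
transform of `b` in every frame satisfies `W'`, then below every such divisor satisfies `W`. [OURS · folklore] -/
theorem ncStep (b : MvPowerSeries (Fin 3) k)
    {Z' Z'' : Scheme.{0}} (σ : Z' ⟶ Spec (.of (MvPowerSeries (Fin 3) k))) [IsIntegral Z'] [IsLocallyNoetherian Z']
    (C : Z'.IdealSheafData) (τ : Z'' ⟶ Z') (hτ : IsBlowup τ C) (hreg : Scheme.IsRegular C.subscheme) (hC : C ≠ ⊥)
    (hsuppV : (C.support : Set Z') ⊆ σ ⁻¹' ((Spec (.of (MvPowerSeries (Fin 3) k))).zeroLocus (U := ⊤)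
      {(Scheme.ΓSpecIso (.of (MvPowerSeries (Fin 3) k))).inv.hom b} : Set _))
    (W W' : MvPowerSeries (Fin 3) k → Prop) (hmono : ∀ g, W' g → W g)
    (hmove : ∀ (g : MvPowerSeries (Fin 3) k) (Φ : Fin 3 → MvPowerSeries (Fin 3) k) (w : Fin 3 → ℕ),
      (∀ i, MvPowerSeries.constantCoeff (Φ i) = 0) →
      IsUnit (Matrix.det (Matrix.of fun i j => MvPowerSeries.coeff (Finsupp.single j 1) (Φ i))) →
      (∀ i, w i ≤ 1) → (∃ i, 0 < w i) →
      (∀ c : Fin 3 → k, (∀ i, w i = 0 → c i = 0) → c ≠ 0 →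
        ∀ (A : ℕ) (G : MvPowerSeries (Fin (3 + 1)) k),
          MvPowerSeries.subst (CobordantChart.chart w c) (MvPowerSeries.subst Φ g) = MvPowerSeries.X 0 ^ A * G →
          ¬ (MvPowerSeries.X (0 : Fin (3 + 1)) ∣ G) →
          ∃ i : Fin 3, c i ≠ 0 ∧ W' (MvPowerSeries.X 0 * TupleGame.slice i G)) →
      W g)
    (h : ∀ (x' : Z'') (hN'' : IsNoetherianRing (Z''.presheaf.stalk x')) (F'' : @Frame k _ Z'' (τ ≫ σ) x' hN'')
      (g : MvPowerSeries (Fin 3) k), g ≠ 0 → g ∣ F''.e (algebraMap _ _ (totalGerm (τ ≫ σ) x' b)) → W' g)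
    (z : Z') (hN : IsNoetherianRing (Z'.presheaf.stalk z)) (F : @Frame k _ Z' σ z hN)
    (g : MvPowerSeries (Fin 3) k) (hg0 : g ≠ 0) (hg : g ∣ F.e (algebraMap _ _ (totalGerm σ z b))) : W g := by
  classical
  by_cases hz : z ∈ C.support
  swap
  · -- off the centre: same reading one floor up
    obtain ⟨x', hN'', F'', hF''⟩ := exists_frame_over_of_not_mem_support b σ C τ hτ hz hN F
    exact hmono g (h x' hN'' F'' g hg0 (by rw [hF'']; exact hg))
  haveI := hN
  haveI := F.isRegularLocalRing
  haveI : IsDomain (MvPowerSeries (Fin 3) k) := NoZeroDivisors.to_isDomain _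
  -- the centre at `z`: part of a regular system of parameters
  have hCle : stalkIdeal C z ≤ maximalIdeal _ := (mem_support_iff_stalkIdeal_le C z).mp hz
  haveI := isRegularLocalRing_quotient_of_isRegular_subscheme C hreg hz
  obtain ⟨u, huspan, S, hCS⟩ := exists_rsop_of_isRegularLocalRing_quotient hCle
  have hd3 : (maximalIdeal (Z'.presheaf.stalk z)).spanFinrank = 3 := by
    have h1 := IsRegularLocalRing.spanFinrank_maximalIdeal (R := Z'.presheaf.stalk z)
    rw [F.ringKrullDim_eq] at h1
    exact_mod_cast h1
  obtain ⟨n, hn3, x, hxr, hxS, hn1⟩ := exists_prefix_reindex hd3 u S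
  have hxspan : Ideal.span (Set.range x) = maximalIdeal _ := by rw [hxr, huspan]
  have hCx : stalkIdeal C z = Ideal.span (Set.range fun l : Fin n => x (Fin.castLE hn3 l)) := by
    rw [hCS, hxS]
  replace hn1 : 1 ≤ n := by
    refine hn1 (Set.nonempty_iff_ne_empty.mpr fun hS => stalkIdeal_ne_bot_of_ne_bot hC z ?_)
    rw [hCS, hS, Set.image_empty, Ideal.span_empty]
  -- the total transform vanishes on the centre
  have hTC : totalGerm σ z b ∈ stalkIdeal C z := totalGerm_mem_stalkIdeal_of_support_subset b σ C hreg hsuppV hz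
  -- change of frame: `F'` adapted to `x`
  obtain ⟨F', hF'⟩ := F.exists_adapted x hxspan
  obtain ⟨φ, hφ0, hφdet, hφe⟩ := Frame.exists_subst F F'
  have hφs : MvPowerSeries.HasSubst φ := MvPowerSeries.hasSubst_of_constantCoeff_zero hφ0
  obtain ⟨M, hM⟩ := hg
  have hTz : F'.e (algebraMap _ _ (totalGerm σ z b)) = MvPowerSeries.subst φ g * MvPowerSeries.subst φ M := by
    rw [hφe, hM, ← MvPowerSeries.coe_substAlgHom hφs, map_mul]
  -- `T_z` read in `F'` lies in the ideal of the centre's coordinates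
  have hTspan : F'.e (algebraMap _ _ (totalGerm σ z b)) ∈
      Ideal.span (Set.range fun l : Fin n => (MvPowerSeries.X (Fin.castLE hn3 l) : MvPowerSeries (Fin 3) k)) := by
    have h1 := Ideal.mem_map_of_mem (F'.e.toRingHom.comp (algebraMap (Z'.presheaf.stalk z)
      (AdicCompletion (maximalIdeal (Z'.presheaf.stalk z)) (Z'.presheaf.stalk z)))) hTC
    rw [hCx, Ideal.map_span] at h1
    refine (Ideal.span_mono ?_) h1
    rintro _ ⟨_, ⟨l, rfl⟩, rfl⟩
    exact ⟨l, (hF' (Fin.castLE hn3 l)).symm⟩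
  -- THE MOVE: the frame change `φ` and the blow-up of the centre, weights `𝟙_{l<n}`
  have hw1 : ∀ l : Fin 3, (fun l : Fin 3 => if (l : ℕ) < n then 1 else 0) l ≤ 1 := fun l => by
    by_cases hl : (l : ℕ) < n <;> simp [hl]
  refine hmove g φ (fun l : Fin 3 => if (l : ℕ) < n then 1 else 0) hφ0 hφdet hw1 ⟨Fin.castLE hn3 ⟨0, hn1⟩, by
      have h : ((Fin.castLE hn3 ⟨0, hn1⟩ : Fin 3) : ℕ) < n := by simp; omega
      simp only [h, if_true, Nat.one_pos]⟩ ?_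
  intro cv hcw hc0 A G hfac hG
  -- a live slot `iN < n`
  obtain ⟨i', hci'⟩ : ∃ i', cv i' ≠ 0 := by
    by_contra hcon
    push Not at hcon
    exact hc0 (funext hcon)
  have hi'n : ((i' : Fin 3) : ℕ) < n := by
    by_contra hc
    exact hci' (hcw i' (by simp [hc]))
  obtain ⟨iN, rfl⟩ : ∃ iN : Fin n, Fin.castLE hn3 iN = i' := ⟨⟨i', hi'n⟩, Fin.ext rfl⟩
  have hcv : ∀ l : Fin 3, n ≤ (l : ℕ) → cv l = 0 := fun l hl => hcw l (by simp [not_lt.mpr hl])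
  refine ⟨Fin.castLE hn3 iN, hci', ?_⟩
  -- the Refuter's point: translated generators, chart ring map, prime, point (Track C, verbatim)
  obtain ⟨u', hu'⟩ : ∃ u' : Fin n → Z'.presheaf.stalk z, u' = fun l => if l = iN then x (Fin.castLE hn3 iN)
      else x (Fin.castLE hn3 l) - stalkConst σ z (cv (Fin.castLE hn3 l) / cv (Fin.castLE hn3 iN)) *
        x (Fin.castLE hn3 iN) := ⟨_, rfl⟩
  have hu'i : u' iN = x (Fin.castLE hn3 iN) := by rw [hu']; simp
  have hu'l : ∀ l, l ≠ iN → u' l = x (Fin.castLE hn3 l) -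
      stalkConst σ z (cv (Fin.castLE hn3 l) / cv (Fin.castLE hn3 iN)) * x (Fin.castLE hn3 iN) := by
    intro l hl; rw [hu']; simp [hl]
  have hu'span : Ideal.span (Set.range u') = stalkIdeal C z := by
    rw [hCx]; exact span_translated_eq hn3 x iN _ u' hu'i hu'l
  obtain ⟨χ, hχb, hχe, hχm⟩ := exists_chartHom F' x hF' hn3 cv iN hci' hcv u' hu'i hu'l
  let w𝔴 : Spec (.of (chartRing u' iN)) := ⟨Ideal.comap χ (maximalIdeal _), Ideal.IsPrime.comap _⟩
  have hw : w𝔴.asIdeal.comap (chartBase u' iN) = maximalIdeal _ := by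
    change (Ideal.comap χ _).comap _ = _
    rw [Ideal.comap_comap]; exact hχm
  obtain ⟨x', q, hx'z, hqw, hiso, hsq⟩ := IsBlowup.exists_point_of_chart hτ z u' hu'span iN w𝔴 hw
  subst hx'z
  have hnm : n + (3 - n) = 3 := by omega
  obtain ⟨wv, hwv'⟩ : ∃ wv : Fin (3 - n) → Z'.presheaf.stalk (τ x'),
      wv = fun j : Fin (3 - n) => x ⟨n + (j : ℕ), by have := j.2; omega⟩ := ⟨_, rfl⟩
  have hwv : ∀ j : Fin (3 - n), wv j = x ⟨n + (j : ℕ), by have := j.2; omega⟩ := fun j => by rw [hwv']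
  have hzspan : Ideal.span (Set.range (Fin.append u' wv)) = maximalIdeal _ := by
    rw [range_fin_append, Ideal.span_union, hu'span, hCx, ← Ideal.span_union, ← hxspan,
      range_eq_union_prefix hnm x, hwv']
  obtain ⟨hN'', F'', hsqr⟩ := exists_frame_square σ C τ hτ x' F' x hF' hnm cv iN hci' hcv u' hu'i hu'l wv hwv hzspan
    χ hχb hχe w𝔴 rfl q hqw hiso hsq
  -- the total transform above reads as the restricted chart substitution of the one below
  have hρs : MvPowerSeries.HasSubst (fun l : Fin 3 => (MvPowerSeries.X 0 : MvPowerSeries (Fin 3) k) ^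
      (if (l : ℕ) < n then 1 else 0) * (MvPowerSeries.C (cv l) + if l = Fin.castLE hn3 iN then
        (0 : MvPowerSeries (Fin 3) k) else MvPowerSeries.X (Fin.predAbove (Fin.castLE hn3 iN) l.succ))) :=
    MvPowerSeries.hasSubst_of_constantCoeff_zero (constantCoeff_rchart cv _ n hcv)
  have hT'' : F''.e (algebraMap _ _ (totalGerm (τ ≫ σ) x' b)) =
      MvPowerSeries.subst (fun l : Fin 3 => (MvPowerSeries.X 0 : MvPowerSeries (Fin 3) k) ^
        (if (l : ℕ) < n then 1 else 0) * (MvPowerSeries.C (cv l) + if l = Fin.castLE hn3 iN then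
          (0 : MvPowerSeries (Fin 3) k) else MvPowerSeries.X (Fin.predAbove (Fin.castLE hn3 iN) l.succ)))
        (F'.e (algebraMap _ _ (totalGerm σ (τ x') b))) := by
    have hof : ∀ a : Z'.presheaf.stalk (τ x'), DeJong1996.completedStalkMap τ x' (algebraMap _ _ a) =
        algebraMap (Z''.presheaf.stalk x') _ ((τ.stalkMap x').hom a) := fun a => DeJong1996.completedStalkMap_of τ x' a
    rw [totalGerm_comp, ← hof]
    exact hsqr _
  -- the restricted chart is the chart followed by the slice at `iN`
  have hch := CobordantChart.hasSubst_chart (fun l : Fin 3 => if (l : ℕ) < n then 1 else 0) cv hcw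
  have hrch : ∀ H : MvPowerSeries (Fin 3) k,
      MvPowerSeries.subst (fun l : Fin 3 => (MvPowerSeries.X 0 : MvPowerSeries (Fin 3) k) ^
        (if (l : ℕ) < n then 1 else 0) * (MvPowerSeries.C (cv l) + if l = Fin.castLE hn3 iN then
          (0 : MvPowerSeries (Fin 3) k) else MvPowerSeries.X (Fin.predAbove (Fin.castLE hn3 iN) l.succ))) H =
      TupleGame.slice (Fin.castLE hn3 iN)
        (MvPowerSeries.subst (CobordantChart.chart (fun l : Fin 3 => if (l : ℕ) < n then 1 else 0) cv) H) := by
    intro H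
    have h1 := SliceChart.subst_restrictedChart (fun l : Fin 3 => if (l : ℕ) < n then 1 else 0) cv hcw H 0
      (MvPowerSeries.subst (CobordantChart.chart (fun l : Fin 3 => if (l : ℕ) < n then 1 else 0) cv) H)
      (by rw [pow_zero, one_mul]) (Fin.castLE hn3 iN)
    rw [pow_zero, one_mul] at h1
    exact h1
  -- `s ∣ T_z∘φ∘chart`: the centre's coordinates go to multiples of `s`
  have hXT : (MvPowerSeries.X (0 : Fin (3 + 1)) : MvPowerSeries (Fin (3 + 1)) k) ∣
      MvPowerSeries.subst (CobordantChart.chart (fun l : Fin 3 => if (l : ℕ) < n then 1 else 0) cv)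
        (F'.e (algebraMap _ _ (totalGerm σ (τ x') b))) := by
    obtain ⟨cf, hcf⟩ := Ideal.mem_span_range_iff_exists_fun.mp hTspan
    rw [← hcf, ← MvPowerSeries.coe_substAlgHom hch, map_sum]
    refine Finset.dvd_sum fun l _ => ?_
    rw [map_mul, MvPowerSeries.coe_substAlgHom, MvPowerSeries.subst_X hch, CobordantChart.chart_apply]
    have hl : ((Fin.castLE hn3 l : Fin 3) : ℕ) < n := by simp
    simp only [hl, if_true, pow_one]
    exact Dvd.dvd.mul_left (dvd_mul_right _ _) _
  -- `s · G ∣ T_z∘φ∘chart`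
  have hsGT : MvPowerSeries.X (0 : Fin (3 + 1)) * G ∣
      MvPowerSeries.subst (CobordantChart.chart (fun l : Fin 3 => if (l : ℕ) < n then 1 else 0) cv)
        (F'.e (algebraMap _ _ (totalGerm σ (τ x') b))) := by
    have hprod : MvPowerSeries.subst (CobordantChart.chart (fun l : Fin 3 => if (l : ℕ) < n then 1 else 0) cv)
        (F'.e (algebraMap _ _ (totalGerm σ (τ x') b))) = MvPowerSeries.X 0 ^ A * G *
          MvPowerSeries.subst (CobordantChart.chart (fun l : Fin 3 => if (l : ℕ) < n then 1 else 0) cv)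
            (MvPowerSeries.subst φ M) := by
      rw [hTz, ← MvPowerSeries.coe_substAlgHom hch, map_mul, MvPowerSeries.coe_substAlgHom, hfac]
    rw [hprod] at hXT ⊢
    rcases Nat.eq_zero_or_pos A with hA | hA
    · rw [hA, pow_zero, one_mul] at hXT ⊢
      rcases (MvPowerSeries.prime_X' k (0 : Fin (3 + 1))).dvd_or_dvd hXT with h1 | h1
      · exact absurd h1 hG
      · obtain ⟨R'', hR''⟩ := h1
        exact ⟨R'', by rw [hR'']; ring⟩
    · obtain ⟨A', rfl⟩ : ∃ A', A = A' + 1 := ⟨A - 1, by omega⟩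
      exact ⟨MvPowerSeries.X 0 ^ A' * MvPowerSeries.subst
        (CobordantChart.chart (fun l : Fin 3 => if (l : ℕ) < n then 1 else 0) cv) (MvPowerSeries.subst φ M), by ring⟩
  -- slice at `iN`: `s · slice G ∣ T_{x'}` read in `F''`
  refine h x' hN'' F'' _ ?_ ?_
  · exact mul_ne_zero (MvPowerSeries.prime_X' k (0 : Fin 3)).ne_zero
      (TupleDropAssembly.slice_ne_zero (MvPowerSeries.subst φ g) _ cv hcw hw1 A G hfac hG (Fin.castLE hn3 iN) hci')
  · obtain ⟨Q, hQ⟩ := hsGT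
    rw [hT'', hrch, hQ, WildTerminal.slice_mul (m := 3), WildTerminal.slice_mul (m := 3),
      WildTerminal.slice_X_zero (m := 2)]
    exact dvd_mul_right _ _

end Summit.ResolutionOfSingularities.ResolutionOfSingularities.Theorems.TrackC

end
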